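import Mathlib
import HarnessLib
import Summits.ResolutionOfSingularities.ResolutionOfSingularities.Theorems.WildQuotientsWildQuotientResolutionZ9PeeledTerminalChart
import Summits.ResolutionOfSingularities.ResolutionOfSingularities.Theorems.WildQuotientsWildQuotientResolutionBlowupExitBasicOpenSections

/-!
# ℤ9 SPECIMEN (peeled `𝔸⁴/ℤ9`, char 3), brick Z4b part 4b: the ring model of the terminal piece —
# `(k[x][I₂₈ t])_{(x_c²⁸t · r₁t · r₂t)} ≅ L₂ = k[x][(v v')⁻¹]`

(crux stmt-ResolutionOfSingularities-15640 `WildQuotients.WildQuotientResolution`, line `Sketch`; S1 =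
stmt-ResolutionOfSingularities-17941 `CyclicQuotientFourfolds`; chain w45c card-P specimen «peeled 𝔸⁴/ℤ9», variant
V-BR, brick Z4b part 4 (design `L/res-L1-w45c-stub-3/Z4B-PART4-DESIGN.md`, step (4-A1).2–3). [OURS · L1 W4.5c] —
NOT a statement of any manuscript; AI-produced, kernel-checked ≠ expert-reviewed. Def-free.)

For the orbit-norm Rees element `x = (x_c²⁸ t)·(r₁ t)·(r₂ t)` with `ψ₂ r₁ = s²⁸ v²⁸`, `ψ₂ r₂ = s²⁸ v'²⁸` (033's `normT 23`:
`r₁ = σ̄(x_c)²⁸ = (x_c + x_b)²⁸`, `r₂ = σ̄²(x_c)²⁸ = (x_c − x_b + x_a)²⁸` in characteristic 3), the homogeneous localisation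
`(k[x][I₂₈ t])_{(x)}` is the localisation of the smooth chart ring `(…)_{(x_c²⁸ t)} ≅ k[x]` (part 4a) at
`t = (r₁t·r₂t)/(x_c²⁸t)² ↦ (v v')²⁸` (Mathlib `HomogeneousLocalization.Away.isLocalization_mul`), i.e. it is
`L₂ = k[x][(v v')⁻¹]`:

* **`exists_awayNorm_ringEquiv`** — `∃ e₂ : Away (reesGrading I₂₈) x ≃+* L₂` with `e₂ (F/1) = ι₂ (ψ₂ F)` for all `F`.
Remaining for the P₂ package ((4-B)/(4-C) of the design): the fixed-point transfer
(`BlowupExit.map_away_fixed_iff_of_intertwines` with `lift_comp_term`) and 033's sections seam.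
-/

-- single-problem summit: the doubled namespace component `ResolutionOfSingularities` is forced
set_option linter.dupNamespace false

noncomputable section

open MvPolynomial Polynomial HomogeneousLocalization Literature.AlgebraicGeometry.Resolution

namespace Summit.ResolutionOfSingularities.ResolutionOfSingularities.Theorems.WildQuotientResolution.Z9Peeled.Terminal

variable (k : Type) [Field k] (n : ℕ) (a b c d : Fin n)

/-- The exponent table of the 24 generators of `I₂₈` (res-D-pv-033's `e24`, verbatim). -/
local notation3 "e24" => (![(4, 0, 0), (3, 2, 0), (3, 1, 3), (3, 0, 7), (2, 4, 0), (2, 3, 2), (2, 2, 6), (2, 1, 10), (2, 0, 14), (1, 6, 0), (1, 5, 1), (1, 4, 5), (1, 3, 9), (1, 2, 13), (1, 1, 17), (1, 0, 21), (0, 7, 0), (0, 6, 4), (0, 5, 8), (0, 4, 12), (0, 3, 16), (0, 2, 20), (0, 1, 24), (0, 0, 28)] : Fin 24 → ℕ × ℕ × ℕ)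
/-- `v = 1 + s³ x_b′` (slots `s = X c`, `x_b′ = X b`; local shorthand). -/
local notation3 "v₂" => (1 + X c ^ 3 * X b : MvPolynomial (Fin n) k)
/-- `v' = 1 − s³ x_b′ + s⁶ x_a′` (local shorthand). -/
local notation3 "v₂'" => (1 - X c ^ 3 * X b + X c ^ 6 * X a : MvPolynomial (Fin n) k)
/-- `u₂ = v v'` expanded (local shorthand; the element inverted on the terminal piece). -/
local notation3 "u₂" => ((1 + X c ^ 3 * X b) * (1 - X c ^ 3 * X b + X c ^ 6 * X a) : MvPolynomial (Fin n) k)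
/-- The terminal chart ring `L₂ = k[x][(v v')⁻¹]` (local shorthand). -/
local notation3 "L₂" => Localization.Away
  ((1 + X c ^ 3 * X b) * (1 - X c ^ 3 * X b + X c ^ 6 * X a) : MvPolynomial (Fin n) k)
/-- `ι : k[x] → L₂` (local shorthand). -/
local notation3 "ι₂" => algebraMap (MvPolynomial (Fin n) k) (Localization.Away
  ((1 + X c ^ 3 * X b) * (1 - X c ^ 3 * X b + X c ^ 6 * X a) : MvPolynomial (Fin n) k))
/-- `J = (v v')⁻¹ ∈ L₂` (local shorthand). -/
local notation3 "J₂" => (IsLocalization.Away.invSelf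
  ((1 + X c ^ 3 * X b) * (1 - X c ^ 3 * X b + X c ^ 6 * X a) : MvPolynomial (Fin n) k) :
  Localization.Away ((1 + X c ^ 3 * X b) * (1 - X c ^ 3 * X b + X c ^ 6 * X a) : MvPolynomial (Fin n) k))
/-- `iv = (ι v)⁻¹ = ι v' · J` (local shorthand). -/
local notation3 "iv₂" => (algebraMap (MvPolynomial (Fin n) k) (Localization.Away
  ((1 + X c ^ 3 * X b) * (1 - X c ^ 3 * X b + X c ^ 6 * X a) : MvPolynomial (Fin n) k))
    (1 - X c ^ 3 * X b + X c ^ 6 * X a) *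
  (IsLocalization.Away.invSelf
    ((1 + X c ^ 3 * X b) * (1 - X c ^ 3 * X b + X c ^ 6 * X a) : MvPolynomial (Fin n) k) :
    Localization.Away ((1 + X c ^ 3 * X b) * (1 - X c ^ 3 * X b + X c ^ 6 * X a) : MvPolynomial (Fin n) k)))
/-- `iv' = (ι v')⁻¹ = ι v · J` (local shorthand). -/
local notation3 "iv₂'" => (algebraMap (MvPolynomial (Fin n) k) (Localization.Away
  ((1 + X c ^ 3 * X b) * (1 - X c ^ 3 * X b + X c ^ 6 * X a) : MvPolynomial (Fin n) k))
    (1 + X c ^ 3 * X b) *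
  (IsLocalization.Away.invSelf
    ((1 + X c ^ 3 * X b) * (1 - X c ^ 3 * X b + X c ^ 6 * X a) : MvPolynomial (Fin n) k) :
    Localization.Away ((1 + X c ^ 3 * X b) * (1 - X c ^ 3 * X b + X c ^ 6 * X a) : MvPolynomial (Fin n) k)))
/-- The terminal substitution `ψ₂` (local shorthand): `x_a ↦ x_a′ s⁷`, `x_b ↦ x_b′ s⁴`, rest fixed. -/
local notation3 "tm₂" => (fun i : Fin n => if i = a then X a * X c ^ 7
    else if i = b then X b * X c ^ 4 else (X i : MvPolynomial (Fin n) k))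


variable {a b c} in
-- the localisation-of-localisation bookkeeping elaborates slowly over the notation-heavy terms; head-room
set_option maxHeartbeats 1600000 in
/-- **(4-A1).2–3 — the ring model of the terminal piece.** For `x = (x_c²⁸ t)·((r₁ t)·(r₂ t))` with `r₁, r₂ ∈ I₂₈`,
`ψ₂ r₁ = s²⁸ v²⁸`, `ψ₂ r₂ = s²⁸ v'²⁸`: `(k[x][I₂₈ t])_{(x)} ≃+* L₂`, sending `F/1` to `ι (ψ₂ F)`. [OURS · L1 W4.5c] -/
theorem exists_awayNorm_ringEquiv (hab : a ≠ b) (hac : a ≠ c) (hbc : b ≠ c)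
    (g : Fin 24 → MvPolynomial (Fin n) k)
    (hg : ∀ q, g q = X a ^ (e24 q).1 * X b ^ (e24 q).2.1 * X c ^ (e24 q).2.2)
    (r₁ r₂ : MvPolynomial (Fin n) k) (h₁ : r₁ ∈ Ideal.span (Set.range g)) (h₂ : r₂ ∈ Ideal.span (Set.range g))
    (hr₁ : aeval tm₂ r₁ = X c ^ 28 * v₂ ^ 28) (hr₂ : aeval tm₂ r₂ = X c ^ 28 * v₂' ^ 28)
    (x : reesAlgebra (Ideal.span (Set.range g)))
    (hx : x = reesT (g 23) (Ideal.mem_span_range_self (f := g) (x := 23)) * (reesT r₁ h₁ * reesT r₂ h₂)) :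
    ∃ e₂ : HomogeneousLocalization.Away (reesGrading (Ideal.span (Set.range g))) x ≃+* L₂,
      ∀ F : MvPolynomial (Fin n) k,
        e₂ (((fromZeroRingHom (reesGrading (Ideal.span (Set.range g))) (.powers x)).comp
          (reesGrading.zeroRingHom (Ideal.span (Set.range g)))) F) = ι₂ (aeval tm₂ F) := by
  classical
  -- names
  have h23 : g 23 ∈ Ideal.span (Set.range g) := Ideal.mem_span_range_self (f := g) (x := 23)
  have hg23 : g 23 = X c ^ 28 := by rw [hg 23]; simp
  have hf : reesT (g 23) h23 ∈ reesGrading (Ideal.span (Set.range g)) 1 := reesT_mem _ _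
  have hG : reesT r₁ h₁ * reesT r₂ h₂ ∈ reesGrading (Ideal.span (Set.range g)) 2 :=
    SetLike.mul_mem_graded (reesT_mem _ _) (reesT_mem _ _)
  -- the smooth chart ring `B₁ = chartRing g 23 ≃ k[x]` (part 4a)
  obtain ⟨e₁, he₁, -⟩ := exists_chartRing23_ringEquiv k n hab hac hbc g hg
  -- `B₂ = Away x` is the localisation of `B₁` at `t`
  letI alg : Algebra (chartRing g 23) (HomogeneousLocalization.Away (reesGrading (Ideal.span (Set.range g))) x) :=
    (awayMap (reesGrading (Ideal.span (Set.range g))) hG hx).toAlgebra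
  haveI hloc := HomogeneousLocalization.Away.isLocalization_mul hf hG hx one_ne_zero
  -- the image of `t` is `(v v')²⁸`
  have hrc : aeval tm₂ (X c : MvPolynomial (Fin n) k) = X c := by
    rw [MvPolynomial.aeval_X]; simp [hac.symm, hbc.symm]
  have hψ23 : aeval tm₂ (g 23) = X c ^ 28 := by rw [hg23, map_pow, hrc]
  have ht_base : Away.isLocalizationElem hf hG * chartBase g 23 (g 23) ^ 2 = chartBase g 23 (r₁ * r₂) := by
    refine BlowupExit.awayMk_mul_base_pow (reesT (g 23) h23) hf (g 23) (coe_reesT _ _) 2 _ _ (r₁ * r₂) ?_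
    simp only [pow_one, Subalgebra.coe_mul, coe_reesT, Polynomial.monomial_mul_monomial]
  have ht : e₁ (Away.isLocalizationElem hf hG) = u₂ ^ 28 := by
    have h := congrArg e₁ ht_base
    rw [map_mul, map_pow, he₁, he₁, map_mul, hr₁, hr₂, hψ23] at h
    have h' : (X c ^ 28) ^ 2 * e₁ (Away.isLocalizationElem hf hG) = (X c ^ 28) ^ 2 * u₂ ^ 28 := by
      linear_combination h
    exact mul_left_cancel₀ (pow_ne_zero 2 (pow_ne_zero 28 (X_ne_zero c))) h'
  -- `L₂` is also the localisation of `k[x]` at `(v v')²⁸`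
  haveI hL : IsLocalization.Away (u₂ ^ 28) L₂ := by
    have hu : IsUnit (ι₂ (u₂ ^ 27)) := by
      rw [map_pow]; exact (IsLocalization.Away.algebraMap_isUnit u₂).pow 27
    have := IsLocalization.Away.mul_of_isUnit (S := L₂) u₂ (u₂ ^ 27) hu
    rwa [← pow_succ'] at this
  -- the equivalence
  have hbase : ∀ F : MvPolynomial (Fin n) k,
      ((fromZeroRingHom (reesGrading (Ideal.span (Set.range g))) (.powers x)).comp
        (reesGrading.zeroRingHom (Ideal.span (Set.range g)))) F =
      awayMap (reesGrading (Ideal.span (Set.range g))) hG hx (chartBase g 23 F) := by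
    intro F
    rw [RingHom.comp_apply, chartBase, reesChartBase, RingHom.comp_apply, awayMap_fromZeroRingHom]
  refine ⟨IsLocalization.ringEquivOfRingEquiv (M := Submonoid.powers (Away.isLocalizationElem hf hG))
    (T := Submonoid.powers (u₂ ^ 28))
    (HomogeneousLocalization.Away (reesGrading (Ideal.span (Set.range g))) x) L₂ e₁ ?_, fun F => ?_⟩
  · have hm := Submonoid.map_powers (e₁.toMonoidHom : chartRing g 23 →* MvPolynomial (Fin n) k)
      (Away.isLocalizationElem hf hG)
    rw [hm]
    exact congrArg Submonoid.powers ht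
  · rw [hbase F, ← RingHom.algebraMap_toAlgebra (awayMap (reesGrading (Ideal.span (Set.range g))) hG hx),
      IsLocalization.ringEquivOfRingEquiv_eq, he₁]

end Summit.ResolutionOfSingularities.ResolutionOfSingularities.Theorems.WildQuotientResolution.Z9Peeled.Terminal

end
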